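import Summits.Ventures.AbcSig.Rows.XTemplateAB
import Summits.Ventures.AbcSig.Levels.N197
import Summits.Ventures.AbcSig.Levels.N394
import Summits.Ventures.AbcSig.Levels.N394M6X

/-!
# Venture AbcSig — ROW `C2aL197A6AB`: `197^m·xⁿ + 2^a·yⁿ = z²` (SECOND coefficient distribution of the cell; the distribution `xⁿ + 2^a·197^m·yⁿ = z²` is `Rows/C2aL197A6.lean`), class `a ge6` (GENERATED by plean/leanrow.py)

HONEST FRAMING. A row of a COMPUTATION cell (`pub-abcsig`); a CONDITIONAL theorem, no claim on ABC or any summit.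
Hypotheses: `BS04Package` (CITED), `DataComplete` at levels [197, 394] (COMPUTED, two-engine certified
level files), `EisPackage` (CITED: [BS04 (3.1), L4.2, Cor 3.1] + [Sturm 1987]) and `Refines` (COMPUTED) for the orbits whose residual exponent is discharged IN THE KERNEL by a module-M6 certificate (`Levels/N…M6X.lean`), and the listed per-orbit exclusions `hX_…` (CITED; the
row's R5 cell names each) that remain. Everything else is kernel-checked (`Rows/XTemplateC2a.lean`, `Levels/N….lean`). Exponent
range: prime `n ≥ 11`, `n ≠ 197`; `B = 2^a 197^m` with `a, m < n` (n-th-power free).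
Row of record:  (sha256 ; SIGNED 2026-08-22T09:50:52Z by referee (ref-g5)); its R0: THEOREM (uses CITED arithmetic facts) for all primes n >= 11 with n coprime to 12608 — class: candidate SHARPENING/new cell (see IK-applicability.md; lit FRESHN. Exponents left open by the row of record are excluded here via ; kernel-sieve residuals the row of record closes by a cell module (M6 Eisenstein / M4 Kraus certificates) appear as CITED hypotheses .
-/

namespace Summit.Ventures.AbcSig

/-- Row `C2aL197A6AB`: second coefficient distribution `197^m·xⁿ + 2^a·yⁿ = z²` (see module docstring). -/
theorem xrow_C2aL197A6AB (M : NewformModel) (hP : M.BS04Package) (hE : M.EisPackage)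
    (hD197 : M.DataComplete 197 level197Orbits) (hD394 : M.DataComplete 394 level394Orbits)
    (hR_orbit_394_4 : M.Refines 394 orbit_394_4 m6X_394_4)
    (n : ℕ) (hn : n.Prime) (hmin : 11 ≤ n) (hnℓ : n ≠ 197) (a m : ℕ) (ha : 6 ≤ a) (hm : 1 ≤ m) (han : a < n) (hmn : m < n)
    (hX_orbit_197_1 : n ∈ ([11] : List ℕ) → M.Excludes 197 orbit_197_1 (famAB (197 ^ m) (2 ^ a) n (fun _ _ => True)))
    (x y z : ℤ) (hxy1 : x * y ≠ 1) (hxy2 : x * y ≠ -1) : ¬ IsPrimitiveSolution (197 ^ m) (2 ^ a) 1 n x y z := by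
  have hℓ : Nat.Prime 197 := by norm_num
  have h7 : 7 ≤ n := by omega
  have hS197 :=
    (level197_sieve n hn h7 (fun o => M.Excludes 197 o (famAB (197 ^ m) (2 ^ a) n (fun _ _ => True)) ∨ M.ExcludesStd 197 o n) (fun hmem => by
      rcases (by simpa using hmem : n = 7 ∨ n = 11) with rfl | rfl
      · omega
      · exact Or.inl (hX_orbit_197_1 (by simp))) (fun hmem => by
      obtain rfl : n = 7 := by simpa using hmem
      omega))
  have hS394 :=
    (level394_sieve n hn h7 (fun o => M.Excludes 394 o (famAB (197 ^ m) (2 ^ a) n (fun _ _ => True)) ∨ M.ExcludesStd 394 o n) (fun hmem => by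
      obtain rfl : n = 7 := by simpa using hmem
      omega) (fun hmem => by
      obtain rfl : n = 7 := by simpa using hmem
      omega) (fun hmem => by
      obtain rfl : n = 11 := by simpa using hmem
      exact Or.inr (m6c_394_4_n11_excludes M hE hR_orbit_394_4)))
  by_cases ha6 : a = 6
  · subst ha6
    exact xrowC2aAB_a6 197 hℓ (by norm_num) M hP n hn h7 hnℓ hD197 hD394 m hm hmn
      hS197
      hS394 x y z hxy1 hxy2
  · exact xrowC2aAB_age7 197 hℓ (by norm_num) M hP n hn h7 hnℓ hD394 a m (by omega) hm han hmn
      hS394 x y z hxy1 hxy2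

end Summit.Ventures.AbcSig
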